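import Mathlib
import HarnessLib
import Summits.ValiantsHypothesis.ValiantsHypothesis.Theses.MonotoneRestoration
import Literature.Computability.AlgebraicComplexity.ArithCircuit
import Literature.Computability.AlgebraicComplexity.ArithCircuitProofs
import Literature.Computability.AlgebraicComplexity.MonotoneStructure
import Literature.Computability.AlgebraicComplexity.PermanentIrreducible
import Literature.ModelTheory.FiniteModelTheory.CkEquiv
import Summits.ValiantsHypothesis.ValiantsHypothesis.Theorems.MonotoneRestorationMonotoneRestorationQPCosetCount
import Summits.ValiantsHypothesis.ValiantsHypothesis.Theorems.MonotoneRestorationMonotoneRestorationQPSymmetricLB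
import Summits.ValiantsHypothesis.ValiantsHypothesis.Theorems.MonotoneRestorationMonotoneRestorationQPSupportSymmetrisation
import Summits.ValiantsHypothesis.ValiantsHypothesis.Theorems.MonotoneRestorationMonotoneRestorationQPSparseRegime
import Summits.ValiantsHypothesis.ValiantsHypothesis.Theorems.MonotoneRestorationMonotoneRestorationQPBeta
import Literature.Computability.AlgebraicComplexity.SymmetricArithCircuit
import Literature.Computability.AlgebraicComplexity.DawarWilsenach2025Proofs
import Literature.GroupTheory.PermutationGroups.SmallIndexSubgroups
import Summits.ValiantsHypothesis.ValiantsHypothesis.Theorems.MonotoneRestorationQP.Negative.LoadBearing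
import Summits.ValiantsHypothesis.ValiantsHypothesis.Theorems.MonotoneRestorationMonotoneRestorationQPPermSupportCount

/-! TTRL-lite variant V19205 of stmt-ValiantsHypothesis-15886 -/

set_option linter.dupNamespace false

namespace Summit.ValiantsHypothesis.ValiantsHypothesis.Theorems

open Summit.ValiantsHypothesis.ValiantsHypothesis.Theses.MonotoneRestoration
open Literature.Computability.AlgebraicComplexity

/-- TTRL-lite variant V19205 (boundary probe, REFUTED): the row-sum substitution
`X i ↦ ∑ j, X (i, j)` of `esymm (Fin 4) ℝ≥0 2` (i.e. `e₂` of the row sums) is NOT invariant under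
transposition `(i, j) ↦ (j, i)` of the variable matrix.  Witness: evaluate at the point
`x (i, j) = [j = 0]` (first column all ones).  Directly, every row sum is `1`, so the value is
`e₂(1,1,1,1) = choose 4 2 = 6`; after transposing, the row sums are `(4,0,0,0)` and every
`2`-subset of rows contains a row `≠ 0`, so the value is `0`.  Hence the symmetry group of this
witness polynomial is `S₄ × S₄`, not `S₄ ≀ ℤ/2`. -/
theorem stub_esymmRowSums_structure_var19205_false :
    ¬ (MvPolynomial.rename (fun p : Fin 4 × Fin 4 => (p.2, p.1))
        (MvPolynomial.bind₁ (fun i : Fin 4 => ∑ j : Fin 4, MvPolynomial.X (i, j))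
          (MvPolynomial.esymm (Fin 4) NNReal 2)) =
      MvPolynomial.bind₁ (fun i : Fin 4 => ∑ j : Fin 4, MvPolynomial.X (i, j))
        (MvPolynomial.esymm (Fin 4) NNReal 2)) := by
  intro h
  -- value of the untransposed polynomial at the test point: `choose 4 2 = 6`
  have h1 : MvPolynomial.eval (fun p : Fin 4 × Fin 4 => if p.2 = 0 then (1 : NNReal) else 0)
      (MvPolynomial.bind₁ (fun i : Fin 4 => ∑ j : Fin 4, MvPolynomial.X (i, j))
        (MvPolynomial.esymm (Fin 4) NNReal 2)) = 6 := by
    simp only [MvPolynomial.esymm, map_sum, map_prod, MvPolynomial.bind₁_X_right,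
      MvPolynomial.eval_X, Finset.sum_ite_eq', Finset.mem_univ, if_true, Finset.prod_const_one,
      Finset.sum_const, Finset.card_powersetCard, Finset.card_univ, Fintype.card_fin]
    rw [show Nat.choose 4 2 = 6 from by decide]
    norm_num
  -- value of the transposed polynomial at the test point: `0`
  have h2 : MvPolynomial.eval (fun p : Fin 4 × Fin 4 => if p.2 = 0 then (1 : NNReal) else 0)
      (MvPolynomial.rename (fun p : Fin 4 × Fin 4 => (p.2, p.1))
        (MvPolynomial.bind₁ (fun i : Fin 4 => ∑ j : Fin 4, MvPolynomial.X (i, j))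
          (MvPolynomial.esymm (Fin 4) NNReal 2))) = 0 := by
    simp only [MvPolynomial.esymm, map_sum, map_prod, MvPolynomial.bind₁_X_right,
      MvPolynomial.rename_X, MvPolynomial.eval_X]
    refine Finset.sum_eq_zero fun t ht => ?_
    obtain ⟨a, b, hab, rfl⟩ := Finset.card_eq_two.mp (Finset.mem_powersetCard.mp ht).2
    rcases eq_or_ne a 0 with rfl | ha
    · exact Finset.prod_eq_zero (Finset.mem_insert_of_mem (Finset.mem_singleton_self b))
        (by simp [hab.symm])
    · exact Finset.prod_eq_zero (Finset.mem_insert_self a {b}) (by simp [ha])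
  rw [h, h1] at h2
  exact absurd h2 (by norm_num)

end Summit.ValiantsHypothesis.ValiantsHypothesis.Theorems
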